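import Summits.AtomisticToContinuum.HydrodynamicLimit.Theorems.CollisionIsometryCLTAdaptedWeightCLTTimeLocal

/-!
# Stub `stub_duhamel` of the line `contact-source-duhamel`
(crux `CollisionIsometryCLT.AdaptedWeightCLT`, stmt-AtomisticToContinuum-14868, the rev-12
TIME-LOCAL crux; `--supports`)

-- adapted from Theorems/CollisionIsometryCLTAdaptedWeightCLTStubDuhamel.lean

This file is the REV-12 RE-HOME, under the namespace `…ContactSourceDuhamel.TimeLocal.Duhamel`,
of the accepted proof of `stub_duhamel` (p86834,
`Theorems/CollisionIsometryCLTAdaptedWeightCLTStubDuhamel.lean`, namespace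
`…ContactSourceDuhamel.Duhamel`, item stmt-AtomisticToContinuum-12949). That file imports the
rev-11 statements module `Theorems/CollisionIsometryCLTAdaptedWeightCLTStatements.lean`, which
no longer elaborates since the route restatement of rev 12 (`lean check` rc 1: type mismatch of
`Iff.rfl` at `adaptedWeightCLT_iff`) and cannot be amended append-only; hence the accepted proof
is unimportable for the rev-12 item. The predicate `TimeLocal.DuhamelIdentity`
(`Theorems/CollisionIsometryCLTAdaptedWeightCLTTimeLocal.lean`) has the byte-identical body of the
rev-11 `DuhamelIdentity`, and the proof below is the p86834 text verbatim against it (only the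
import, the namespace lines and this header changed).

VARIATION OF CONSTANTS along the collision sequence of the typed fold: for every `σ`,
`DuhamelIdentity σ`, i.e. for all ranks `r ≥ 1`, all `N`, window starts `y`, shifts `u` and numbers
of fold steps `m`,
`(i ↦ (velAfter m i − u)^{⊗r}) = 𝒯_{0→m} (k ↦ ((y k).2 − u)^{⊗r}) + Σ_{l<m} 𝒯_{l+1→m} src_l`.

This is exact algebra (no dynamics, no measure theory), true for every `σ`:
* one fold step `stepMap σ N y k` is the identity when `stepPair σ N y k = none`, and otherwise the
  velocity part of `collidePair` at the pair `(p, q)`, `p < q`, with normal `n = stepNormal σ N y k`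
  (`stepMap_of_some`, `stepNormal_of_some`), whose reflection law `reflectVel` reads, after the
  shift, `W'_p − u = Q (W_p − u) + P (W_q − u)`, `W'_q − u = Q (W_q − u) + P (W_p − u)` with
  `P = projV n`, `Q = coprojV n` (`reflect_fst_shift`, `reflect_snd_shift`);
* the rank-`r` binomial split `tpow r (a + b) = tpow r a + tpow r b + crossT r a b` for `0 < r`
  (`tpow_add`, `Fintype.prod_add` over the slots) and `mapT M (tpow r a) = tpow r (M a)` with
  `coprojM n · a = coprojV n a`, `projM n · b = projV n b` (`mapT_coprojM_tpow`, `mapT_projM_tpow`),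
  whence the one-collision identity `tpow_coproj_add_proj`;
* `tStep` is additive (`tStep_add`, `tStep_sum`) and is the linear part of the step, `src` the cross
  part (`tpow_velAfter_succ`);
* induction on `m` (`duhamel`), with `transferSteps (m+1) = stepMap m ∘ transferSteps m` and
  `tTransport m₁ (n+1) = tStep (m₁+n) ∘ tTransport m₁ n`.
-/

namespace Summit.AtomisticToContinuum.HydrodynamicLimit.Theorems.ContactSourceDuhamel.TimeLocal
namespace Duhamel

open scoped BigOperators Topology Classical MeasureTheory ENNReal InnerProductSpace
open Filter Set MeasureTheory
open Literature.Analysis.FluidPDE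
open Literature.MathematicalPhysics.KineticTheory (hsDiameter)

noncomputable section

variable {σ : ℝ} {N : ℕ} {y : Cfg N} {r : ℕ}

/-! ## The fold, step by step -/

/-- The pair reflected at a fold step is ordered: `p < q` (`Alexander.mem_incomingPairs`). -/
theorem stepPair_fst_lt_snd {k : ℕ} {p q : Fin (N + 1)} (h : stepPair σ N y k = some (p, q)) :
    p < q := by
  unfold stepPair at h
  by_cases hne : (Alexander.incomingPairs (Torus.geometry (Fin 3)) (hsDiameter σ N)
      (pre σ N y k)).Nonempty
  · simp only [dif_pos hne, Option.some.injEq] at h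
    have hlt := (Alexander.mem_incomingPairs.1 hne.some_mem).1
    rw [h] at hlt
    exact hlt
  · rw [dif_neg hne] at h
    exact (Option.some_ne_none _ h.symm).elim

/-- A fold step without incoming pair is the identity on velocity fields. -/
theorem stepMap_of_none {k : ℕ} (h : stepPair σ N y k = none) (W : Vel N) :
    stepMap σ N y k W = W := by
  unfold stepPair at h
  unfold stepMap
  by_cases hne : (Alexander.incomingPairs (Torus.geometry (Fin 3)) (hsDiameter σ N)
      (pre σ N y k)).Nonempty
  · rw [dif_pos hne] at h
    exact (Option.some_ne_none _ h).elim
  · rw [dif_neg hne]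

/-- A fold step with incoming pair `(p, q)` is the velocity part of `collidePair` at `(p, q)`
applied to the velocity field placed at the positions of `pre k`. -/
theorem stepMap_of_some {k : ℕ} {p q : Fin (N + 1)} (h : stepPair σ N y k = some (p, q))
    (W : Vel N) :
    stepMap σ N y k W = fun i =>
      (collidePair (Torus.geometry (Fin 3)) p q (fun j => ((pre σ N y k j).1, W j)) i).2 := by
  unfold stepPair at h
  by_cases hne : (Alexander.incomingPairs (Torus.geometry (Fin 3)) (hsDiameter σ N)
      (pre σ N y k)).Nonempty
  · simp only [dif_pos hne, Option.some.injEq] at h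
    unfold stepMap
    rw [dif_pos hne, h]
  · rw [dif_neg hne] at h
    exact (Option.some_ne_none _ h.symm).elim

/-- The normal of a fold step with incoming pair `(p, q)` is the separation vector of the pair in
`pre k` — the direction `collidePair` reflects in. -/
theorem stepNormal_of_some {k : ℕ} {p q : Fin (N + 1)} (h : stepPair σ N y k = some (p, q)) :
    stepNormal σ N y k =
      (Torus.geometry (Fin 3)).sepVec (pre σ N y k p).1 (pre σ N y k q).1 := by
  simp only [stepNormal, h]

/-- `transferSteps (m + 1) = stepMap m ∘ transferSteps m`. -/
theorem transferSteps_succ_step (m : ℕ) (W : Vel N) :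
    transferSteps σ N y (m + 1) W = stepMap σ N y m (transferSteps σ N y m W) := by
  simp only [transferSteps, List.range_succ, List.foldl_append, List.foldl_cons, List.foldl_nil]

/-- `velAfter (m + 1) = stepMap m (velAfter m)`. -/
theorem velAfter_succ (m : ℕ) : velAfter σ N y (m + 1) = stepMap σ N y m (velAfter σ N y m) :=
  transferSteps_succ_step m _

/-- `velAfter 0` is the velocity field of `y`. -/
theorem velAfter_zero_eq : velAfter σ N y 0 = fun i => (y i).2 := by
  simp [velAfter, transferSteps]

/-! ## Tensor algebra -/

/-- `mapT M` is additive. -/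
theorem mapT_add (M : Mat3) (A B : Tens r) : mapT M (A + B) = mapT M A + mapT M B := by
  funext idx
  simp only [mapT, Pi.add_apply, mul_add, Finset.sum_add_distrib]

/-- `M^{⊗r}` of a rank-one power is the power of the mapped vector. -/
theorem mapT_tpow (M : Mat3) (a : V3) (idx : Fin r → Fin 3) :
    mapT M (tpow r a) idx = ∏ s, ∑ d, M (idx s) d * a d := by
  simp only [mapT, tpow]
  rw [Fintype.prod_sum]
  exact Finset.sum_congr rfl fun idx' _ => Finset.prod_mul_distrib.symm

/-- `⟪n, a⟫ = Σ_d n_d a_d` on `ℝ³`. -/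
theorem inner_eq_sum (n a : V3) : ⟪n, a⟫_ℝ = ∑ d, n d * a d := by
  simp only [PiLp.inner_apply, RCLike.inner_apply, conj_trivial]
  exact Finset.sum_congr rfl fun d _ => mul_comm _ _

/-- The rows of `coprojM n` act as `coprojV n`. -/
theorem coprojM_mulVec (n a : V3) (c : Fin 3) : ∑ d, coprojM n c d * a d = coprojV n a c := by
  simp only [coprojM, coprojV, projV, sub_mul, Finset.sum_sub_distrib, ite_mul, one_mul, zero_mul,
    Finset.sum_ite_eq, Finset.mem_univ, if_true, PiLp.sub_apply, PiLp.smul_apply, smul_eq_mul,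
    inner_eq_sum]
  rw [Finset.sum_div, Finset.sum_mul]
  exact congrArg _ (Finset.sum_congr rfl fun d _ => by ring)

/-- The rows of `projM n` act as `projV n`. -/
theorem projM_mulVec (n a : V3) (c : Fin 3) : ∑ d, projM n c d * a d = projV n a c := by
  simp only [projM, projV, PiLp.smul_apply, smul_eq_mul, inner_eq_sum]
  rw [Finset.sum_div, Finset.sum_mul]
  exact Finset.sum_congr rfl fun d _ => by ring

/-- `Q^{⊗r} a^{⊗r} = (Q a)^{⊗r}`. -/
theorem mapT_coprojM_tpow (n a : V3) : mapT (coprojM n) (tpow r a) = tpow r (coprojV n a) := by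
  funext idx
  rw [mapT_tpow]
  simp only [tpow, coprojM_mulVec]

/-- `P^{⊗r} b^{⊗r} = (P b)^{⊗r}`. -/
theorem mapT_projM_tpow (n a : V3) : mapT (projM n) (tpow r a) = tpow r (projV n a) := by
  funext idx
  rw [mapT_tpow]
  simp only [tpow, projM_mulVec]

/-- The rank-`r` BINOMIAL SPLIT (`0 < r`): `(a + b)^{⊗r} = a^{⊗r} + b^{⊗r} + crossT r a b`
(`Fintype.prod_add` over the slots; the subsets `S = ∅`, `S = univ` are the two pure powers, the
rest is `crossT`; at `r = 0` the two coincide and the identity fails, whence `0 < r`). -/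
theorem tpow_add (hr : 0 < r) (a b : V3) :
    tpow r (a + b) = tpow r a + tpow r b + crossT r a b := by
  haveI : Nonempty (Fin r) := ⟨⟨0, hr⟩⟩
  have hne : (Finset.univ : Finset (Fin r)) ≠ ∅ := Finset.univ_nonempty.ne_empty
  funext idx
  set F : Finset (Fin r) → ℝ := fun t => (∏ s ∈ t, b (idx s)) * ∏ s ∈ tᶜ, a (idx s) with hFdef
  have hL : tpow r (a + b) idx = ∑ t, F t := by
    simp only [hFdef, tpow, PiLp.add_apply]
    rw [← Fintype.prod_add]
    exact Finset.prod_congr rfl fun s _ => add_comm _ _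
  have hF : ∀ t : Finset (Fin r), (∏ s, if s ∈ t then b (idx s) else a (idx s)) = F t := by
    intro t
    simp only [hFdef]
    rw [← Finset.prod_mul_prod_compl t]
    congr 1
    · exact Finset.prod_congr rfl fun s hs => if_pos hs
    · exact Finset.prod_congr rfl fun s hs => if_neg (Finset.mem_compl.1 hs)
  have h1 : F ∅ = tpow r a idx := by simp [hFdef, tpow]
  have h2 : F Finset.univ = tpow r b idx := by simp [hFdef, tpow]
  have h3 : (Finset.univ.erase ∅).erase (Finset.univ : Finset (Fin r)) =
      Finset.univ.filter (fun S : Finset (Fin r) => S ≠ ∅ ∧ S ≠ Finset.univ) := by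
    ext S
    simp only [Finset.mem_erase, Finset.mem_filter, Finset.mem_univ, and_true, true_and]
    tauto
  rw [hL, ← Finset.add_sum_erase _ _ (Finset.mem_univ (∅ : Finset (Fin r))),
    ← Finset.add_sum_erase _ _ (Finset.mem_erase.2 ⟨hne, Finset.mem_univ _⟩), h1, h2, h3,
    ← add_assoc]
  change _ = tpow r a idx + tpow r b idx + crossT r a b idx
  congr 1
  simp only [crossT]
  refine Finset.sum_congr ?_ fun t _ => (hF t).symm
  ext S
  simp

/-- Shifted post-collisional velocity of the FIRST particle of a reflected pair:
`v − (⟪v − w, n⟫/‖n‖²) n − u = Q (v − u) + P (w − u)`. -/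
theorem reflect_fst_shift (n v w u : V3) :
    v - (⟪v - w, n⟫_ℝ / ‖n‖ ^ 2) • n - u = coprojV n (v - u) + projV n (w - u) := by
  simp only [coprojV, projV, real_inner_comm n (v - w), inner_sub_right]
  module

/-- Shifted post-collisional velocity of the SECOND particle of a reflected pair:
`w + (⟪v − w, n⟫/‖n‖²) n − u = Q (w − u) + P (v − u)`. -/
theorem reflect_snd_shift (n v w u : V3) :
    w + (⟪v - w, n⟫_ℝ / ‖n‖ ^ 2) • n - u = coprojV n (w - u) + projV n (v - u) := by
  simp only [coprojV, projV, real_inner_comm n (v - w), inner_sub_right]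
  module

/-- The one-collision identity for rank-`r` powers:
`(Q a + P b)^{⊗r} = Q^{⊗r} a^{⊗r} + P^{⊗r} b^{⊗r} + crossT r (Q a) (P b)`. -/
theorem tpow_coproj_add_proj (hr : 0 < r) (n a b : V3) :
    tpow r (coprojV n a + projV n b) =
      mapT (coprojM n) (tpow r a) + mapT (projM n) (tpow r b) +
        crossT r (coprojV n a) (projV n b) := by
  rw [tpow_add hr, mapT_coprojM_tpow, mapT_projM_tpow]

/-! ## Incoherent transport and sources, step by step -/

/-- `tStep` at an identity step. -/
theorem tStep_of_none {k : ℕ} (h : stepPair σ N y k = none) (T : Fin (N + 1) → Tens r) :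
    tStep r σ N y k T = T := by
  simp only [tStep, h]

/-- `tStep` at a step reflecting `(p, q)`. -/
theorem tStep_of_some {k : ℕ} {p q : Fin (N + 1)} (h : stepPair σ N y k = some (p, q))
    (T : Fin (N + 1) → Tens r) :
    tStep r σ N y k T =
      Function.update (Function.update T p
          (mapT (coprojM (stepNormal σ N y k)) (T p) + mapT (projM (stepNormal σ N y k)) (T q)))
        q (mapT (coprojM (stepNormal σ N y k)) (T q) +
          mapT (projM (stepNormal σ N y k)) (T p)) := by
  simp only [tStep, h]

/-- `src` at an identity step vanishes. -/
theorem src_of_none {l : ℕ} (h : stepPair σ N y l = none) (u : V3) : src r σ N y u l = 0 := by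
  simp only [src, h]

/-- `src` at a step reflecting `(p, q)`. -/
theorem src_of_some {l : ℕ} {p q : Fin (N + 1)} (h : stepPair σ N y l = some (p, q)) (u : V3) :
    src r σ N y u l =
      Function.update (Function.update (0 : Fin (N + 1) → Tens r) p
          (crossT r (coprojV (stepNormal σ N y l) (velAfter σ N y l p - u))
            (projV (stepNormal σ N y l) (velAfter σ N y l q - u))))
        q (crossT r (coprojV (stepNormal σ N y l) (velAfter σ N y l q - u))
            (projV (stepNormal σ N y l) (velAfter σ N y l p - u))) := by
  simp only [src, h]

/-- `tStep` is additive in the tensor family. -/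
theorem tStep_add (k : ℕ) (F F' : Fin (N + 1) → Tens r) :
    tStep r σ N y k (F + F') = tStep r σ N y k F + tStep r σ N y k F' := by
  rcases h : stepPair σ N y k with _ | ⟨p, q⟩
  · simp only [tStep_of_none h]
  · simp only [tStep_of_some h]
    funext i
    simp only [Function.update_apply, Pi.add_apply, mapT_add]
    split_ifs <;> abel

/-- `tStep 0 = 0`. -/
theorem tStep_zero (k : ℕ) : tStep r σ N y k (0 : Fin (N + 1) → Tens r) = 0 := by
  have h := tStep_add (r := r) (σ := σ) (y := y) k 0 0
  rw [add_zero] at h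
  simpa using h

/-- `tStep` commutes with finite sums of tensor families. -/
theorem tStep_sum {ι : Type*} (k : ℕ) (s : Finset ι) (F : ι → Fin (N + 1) → Tens r) :
    tStep r σ N y k (∑ l ∈ s, F l) = ∑ l ∈ s, tStep r σ N y k (F l) :=
  map_sum (⟨⟨tStep r σ N y k, tStep_zero k⟩, tStep_add k⟩ :
    (Fin (N + 1) → Tens r) →+ (Fin (N + 1) → Tens r)) F s

/-- `tTransport m₁ 0 = id`. -/
theorem tTransport_zero (m₁ : ℕ) (T : Fin (N + 1) → Tens r) : tTransport r σ N y m₁ 0 T = T := by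
  simp [tTransport]

/-- `tTransport m₁ (n + 1) = tStep (m₁ + n) ∘ tTransport m₁ n`. -/
theorem tTransport_succ (m₁ n : ℕ) (T : Fin (N + 1) → Tens r) :
    tTransport r σ N y m₁ (n + 1) T = tStep r σ N y (m₁ + n) (tTransport r σ N y m₁ n T) := by
  rw [tTransport, tTransport, List.range'_1_concat, List.foldl_append]
  rfl

/-! ## Variation of constants -/

/-- ONE STEP of the variation of constants: the rank-`r` powers of the shifted velocities after
step `m` are the incoherent transport of those before plus the contact source of step `m`. -/
theorem tpow_velAfter_succ (hr : 0 < r) (u : V3) (m : ℕ) :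
    (fun i => tpow r (velAfter σ N y (m + 1) i - u)) =
      tStep r σ N y m (fun i => tpow r (velAfter σ N y m i - u)) + src r σ N y u m := by
  rw [velAfter_succ]
  rcases h : stepPair σ N y m with _ | ⟨p, q⟩
  · rw [stepMap_of_none h, tStep_of_none h, src_of_none h, add_zero]
  · have hpq : p ≠ q := ne_of_lt (stepPair_fst_lt_snd h)
    rw [stepMap_of_some h, tStep_of_some h, src_of_some h]
    funext i
    simp only [Pi.add_apply]
    by_cases hiq : i = q
    · subst hiq
      rw [Function.update_self, Function.update_self, collidePair_apply_right]
      simp only [reflectVel]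
      rw [← stepNormal_of_some h, reflect_snd_shift, tpow_coproj_add_proj hr]
    · rw [Function.update_of_ne hiq, Function.update_of_ne hiq]
      by_cases hip : i = p
      · subst hip
        rw [Function.update_self, Function.update_self, collidePair_apply_left hpq]
        simp only [reflectVel]
        rw [← stepNormal_of_some h, reflect_fst_shift, tpow_coproj_add_proj hr]
      · rw [Function.update_of_ne hip, Function.update_of_ne hip, collidePair_apply_of_ne hip hiq]
        simp

/-- The DUHAMEL IDENTITY of the typed fold at `(σ, r, N, y, u, m)`, `0 < r`: induction on `m`. -/
theorem duhamel (hr : 0 < r) (u : V3) (m : ℕ) :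
    (fun i => tpow r (velAfter σ N y m i - u)) =
      tTransport r σ N y 0 m (fun k => tpow r ((y k).2 - u)) +
        ∑ l ∈ Finset.range m, tTransport r σ N y (l + 1) (m - (l + 1)) (src r σ N y u l) := by
  induction m with
  | zero => simp [velAfter_zero_eq, tTransport_zero]
  | succ m ih =>
    rw [tpow_velAfter_succ hr u m, ih, tStep_add, tStep_sum, Finset.sum_range_succ,
      tTransport_succ, zero_add, Nat.sub_self, tTransport_zero, add_assoc]
    congr 2
    refine Finset.sum_congr rfl fun l hl => ?_
    have hlm : l < m := Finset.mem_range.1 hl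
    rw [show m + 1 - (l + 1) = m - (l + 1) + 1 by omega, tTransport_succ,
      show l + 1 + (m - (l + 1)) = m by omega]

/-- STUB 1 of the line `contact-source-duhamel` (VARIATION OF CONSTANTS along the collision
sequence, exact algebra): for every `σ` the Duhamel identity of the typed fold holds for all ranks
`r ≥ 1`, all `N`, window starts `y`, shifts `u` and numbers of fold steps `m`:
`Y^{(m)} = 𝒯_{0→m} Y^{(0)} + Σ_{l<m} 𝒯_{l+1→m} src_l`. -/
theorem stub_duhamel : ∀ σ : ℝ, DuhamelIdentity σ :=
  fun _σ _r _N _y u m hr => duhamel hr u m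

end

end Duhamel
end Summit.AtomisticToContinuum.HydrodynamicLimit.Theorems.ContactSourceDuhamel.TimeLocal
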